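import Summits.MatrixMultiplication.MatrixMultiplication.Theorems.FidelityWitnessesLinearDefectLawFidelity
import Summits.MatrixMultiplication.MatrixMultiplication.Theorems.FidelityWitnessesSevenEighthsLawStubSliceElimination

/-!
# `FidelityWitnesses.LinearDefectLaw` (stmt-MatrixMultiplication-14039) — slot deflation, I: the projection calculus and
# `|⟨S,⟨2,2,2⟩⟩|² ≤ 5‖S‖²` on the `(a,b)`-deficient stratum

Support file for item `stmt-MatrixMultiplication-14039` (`LinearDefectLaw`) of route `MatrixMultiplication/FidelityWitnesses`.
At `n = 2` the law is `SevenEighthsLaw ∧ SixEighthsAtFive ∧ (M(2,4) ≤ 5)` (`TwoIff.lawAtTwo_iff`); the rank-4 rung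
`M(2,4) ≤ 5` ("five eighths at four"; numerically `M(2,4) = 3 + √2`, `Rung24.rung24_ge`) is the only `n = 2` content of the
item not filed elsewhere.  This file and its sequel (`…LinearDefectLawTwoDeficient`) prove that rung OFF THE DOUBLY-CONCISE
STRATUM, for tensors of ANY rank, by an exact projection computation:

* SLOT DEFLATION.  For a unit vector `α` of one slot, `dA α X = X − α ⊗ (cA α X)` (`cA α X = Σ_a conj(α a) X a · ·`) is the
  orthogonal projection of `X` onto `α^⊥ ⊗ · ⊗ ·`; Pythagoras `‖dA α X‖² = ‖X‖² − ‖cA α X‖²` (`nsq_dA`, from the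
  one-dimensional identity `sum_norm_sq_deflate`), and the pairing with any `S` annihilated by `α` in that slot is unchanged
  (`pair_dA`).  Likewise `dB`, `dC`; deflations in different slots commute (`cB_dA`, …).
* THE MARGINALS OF `⟨2,2,2⟩`.  `‖cA α T₂‖² = 2‖α‖²` in every slot (each matrix entry lies in two unit products), and the
  double contraction is a `2 × 2` matrix product: `Σ_c ‖Σ_a conj(α a) cB β T₂ a c‖² = ‖αᵀβ‖²_F ≤ ‖α‖²‖β‖²`.
* Hence `‖(P_{α⊥} ⊗ P_{β⊥} ⊗ 1) T₂‖² = 8 − 2 − 2 + ‖αᵀβ‖² ≤ 5` (`nsq_dB_dA_T₂_le`) and, by Cauchy–Schwarz,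
  `|⟨S,T₂⟩|² = |⟨S, (P_{α⊥}⊗P_{β⊥}⊗1)T₂⟩|² ≤ 5‖S‖²` for every `S` annihilated by unit functionals in the slots `a` and `b`
  (`overlap_sq_le_five_of_annihilated_ab`, registered stub `stub_twoDeficientSlots`) — the rank-4 rung's constant, with no
  rank hypothesis (compare the one-slot constant `6 = 8 − 2` of `sixEighthsAtFive_of_annihilated_b`, p93453).
The sequel treats the pairs `(a,c)`, `(b,c)`, sums of triads, and reduces `M(2,4) ≤ 5` to the doubly-concise stratum.
Vocabulary `P`, `overlap`, `normSq` from `…LinearDefectLawFidelity` (p90158); Cauchy–Schwarz `SevenEighthsLaw.norm_sum_mul_sq_le`.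
-/

noncomputable section

namespace Summit.MatrixMultiplication.MatrixMultiplication.Theorems.LinearDefectLaw.SlotDeflation

open scoped BigOperators ComplexConjugate
open Literature.Computability.AlgebraicComplexity
open Summit.MatrixMultiplication.MatrixMultiplication.Theorems.LinearDefectLaw.Reduction
  (P overlap normSq normSq_nonneg)

set_option linter.dupNamespace false

/-! ## One-dimensional deflation (projection away from a unit vector) -/

/-- **Pythagoras for one deflation step.** For a unit vector `α` (`Σ‖α i‖² = 1`) and any `x`, removing from `x` its
component along `α` — `x − α·s` with `s = Σ conj(α j) x j` — costs exactly `‖s‖²` in squared norm. [folklore] -/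
theorem sum_norm_sq_deflate {ι : Type*} [Fintype ι] (x α : ι → ℂ) (hα : ∑ i, ‖α i‖ ^ 2 = 1) :
    ∑ i, ‖x i - α i * ∑ j, conj (α j) * x j‖ ^ 2 =
      (∑ i, ‖x i‖ ^ 2) - ‖∑ j, conj (α j) * x j‖ ^ 2 := by
  set s : ℂ := ∑ j, conj (α j) * x j with hs
  have hα' : ∑ i, Complex.normSq (α i) = 1 := by
    have : ∑ i, ‖α i‖ ^ 2 = ∑ i, Complex.normSq (α i) :=
      Finset.sum_congr rfl fun i _ => Complex.sq_norm _
    rw [← this, hα]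
  have hterm : ∀ i, ‖x i - α i * s‖ ^ 2 =
      Complex.normSq (x i) + Complex.normSq (α i) * Complex.normSq s
        - 2 * ((conj (α i) * x i) * conj s).re := by
    intro i
    rw [Complex.sq_norm, Complex.normSq_sub, Complex.normSq_mul, map_mul]
    congr 2
    ring
  have hre : ∑ i, ((conj (α i) * x i) * conj s).re = Complex.normSq s := by
    rw [← Complex.re_sum, ← Finset.sum_mul, ← hs, Complex.mul_conj, Complex.ofReal_re]
  simp_rw [hterm]
  rw [Finset.sum_sub_distrib, Finset.sum_add_distrib, ← Finset.sum_mul, hα', one_mul,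
    ← Finset.mul_sum, hre, Complex.sq_norm]
  simp only [Complex.sq_norm]
  ring

/-! ## Slot contractions and deflations of a 3-tensor -/

section Slots

variable {ι κ μ : Type*} [Fintype ι] [Fintype κ] [Fintype μ]

/-- squared Frobenius norm of a 3-tensor on arbitrary finite index types -/
def nsq (X : ι → κ → μ → ℂ) : ℝ := ∑ a, ∑ b, ∑ c, ‖X a b c‖ ^ 2

/-- bilinear pairing `Σ S·X` -/
def pair (S X : ι → κ → μ → ℂ) : ℂ := ∑ a, ∑ b, ∑ c, S a b c * X a b c

/-- slot-`a` contraction with `conj α`: `(b,c) ↦ Σ_a conj(α a) X a b c` -/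
def cA (α : ι → ℂ) (X : ι → κ → μ → ℂ) : κ → μ → ℂ := fun b c => ∑ a, conj (α a) * X a b c

/-- slot-`a` deflation: `X − α ⊗ (cA α X)` (orthogonal projection of `X` onto `α^⊥ ⊗ · ⊗ ·` for unit `α`) -/
def dA (α : ι → ℂ) (X : ι → κ → μ → ℂ) : ι → κ → μ → ℂ := fun a b c => X a b c - α a * cA α X b c

/-- slot-`b` contraction with `conj β` -/
def cB (β : κ → ℂ) (X : ι → κ → μ → ℂ) : ι → μ → ℂ := fun a c => ∑ b, conj (β b) * X a b c

/-- slot-`b` deflation -/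
def dB (β : κ → ℂ) (X : ι → κ → μ → ℂ) : ι → κ → μ → ℂ := fun a b c => X a b c - β b * cB β X a c

/-- slot-`c` contraction with `conj γ` -/
def cC (γ : μ → ℂ) (X : ι → κ → μ → ℂ) : ι → κ → ℂ := fun a b => ∑ c, conj (γ c) * X a b c

/-- slot-`c` deflation -/
def dC (γ : μ → ℂ) (X : ι → κ → μ → ℂ) : ι → κ → μ → ℂ := fun a b c => X a b c - γ c * cC γ X a b

/-- `0 ≤ nsq X` -/
theorem nsq_nonneg (X : ι → κ → μ → ℂ) : 0 ≤ nsq X := by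
  unfold nsq; positivity

/-- **Cauchy–Schwarz for the pairing**: `‖Σ S·X‖² ≤ nsq S · nsq X`. [folklore] -/
theorem norm_pair_sq_le (S X : ι → κ → μ → ℂ) : ‖pair S X‖ ^ 2 ≤ nsq S * nsq X := by
  have h := SevenEighthsLaw.norm_sum_mul_sq_le Finset.univ
    (fun p : ι × κ × μ => S p.1 p.2.1 p.2.2) (fun p => X p.1 p.2.1 p.2.2)
  simpa only [pair, nsq, Fintype.sum_prod_type] using h

/-- cyclic rotation of a triple sum -/
theorem sum_rotate {α β γ : Type*} [Fintype α] [Fintype β] [Fintype γ] {M : Type*} [AddCommMonoid M]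
    (f : α → β → γ → M) : ∑ a, ∑ b, ∑ c, f a b c = ∑ b, ∑ c, ∑ a, f a b c := by
  rw [Finset.sum_comm]
  exact Finset.sum_congr rfl fun b _ => Finset.sum_comm

/-- Pythagoras for slot-`a` deflation: `nsq (dA α X) = nsq X − Σ_{b,c} ‖cA α X b c‖²` (unit `α`). [folklore] -/
theorem nsq_dA (α : ι → ℂ) (hα : ∑ i, ‖α i‖ ^ 2 = 1) (X : ι → κ → μ → ℂ) :
    nsq (dA α X) = nsq X - ∑ b, ∑ c, ‖cA α X b c‖ ^ 2 := by
  unfold nsq dA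
  rw [sum_rotate (fun a b c => ‖X a b c - α a * cA α X b c‖ ^ 2),
    sum_rotate (fun a b c => ‖X a b c‖ ^ 2)]
  have key : ∀ b c, ∑ a, ‖X a b c - α a * cA α X b c‖ ^ 2 = (∑ a, ‖X a b c‖ ^ 2) - ‖cA α X b c‖ ^ 2 :=
    fun b c => sum_norm_sq_deflate (fun a => X a b c) α hα
  simp_rw [key, Finset.sum_sub_distrib]

/-- Pythagoras for slot-`b` deflation. [folklore] -/
theorem nsq_dB (β : κ → ℂ) (hβ : ∑ i, ‖β i‖ ^ 2 = 1) (X : ι → κ → μ → ℂ) :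
    nsq (dB β X) = nsq X - ∑ a, ∑ c, ‖cB β X a c‖ ^ 2 := by
  unfold nsq dB
  have key : ∀ a c, ∑ b, ‖X a b c - β b * cB β X a c‖ ^ 2 = (∑ b, ‖X a b c‖ ^ 2) - ‖cB β X a c‖ ^ 2 :=
    fun a c => sum_norm_sq_deflate (fun b => X a b c) β hβ
  have h1 : ∀ a, (∑ b, ∑ c, ‖X a b c - β b * cB β X a c‖ ^ 2) =
      (∑ b, ∑ c, ‖X a b c‖ ^ 2) - ∑ c, ‖cB β X a c‖ ^ 2 := by
    intro a
    rw [Finset.sum_comm, Finset.sum_comm (f := fun b c => ‖X a b c‖ ^ 2)]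
    simp_rw [key, Finset.sum_sub_distrib]
  simp_rw [h1, Finset.sum_sub_distrib]

/-- Pythagoras for slot-`c` deflation. [folklore] -/
theorem nsq_dC (γ : μ → ℂ) (hγ : ∑ i, ‖γ i‖ ^ 2 = 1) (X : ι → κ → μ → ℂ) :
    nsq (dC γ X) = nsq X - ∑ a, ∑ b, ‖cC γ X a b‖ ^ 2 := by
  unfold nsq dC
  have key : ∀ a b, ∑ c, ‖X a b c - γ c * cC γ X a b‖ ^ 2 = (∑ c, ‖X a b c‖ ^ 2) - ‖cC γ X a b‖ ^ 2 :=
    fun a b => sum_norm_sq_deflate (fun c => X a b c) γ hγ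
  simp_rw [key, Finset.sum_sub_distrib]

/-- Slot-`a` deflation does not change the pairing with a tensor annihilated by `α` in slot `a`. [folklore] -/
theorem pair_dA (α : ι → ℂ) {S : ι → κ → μ → ℂ} (hS : ∀ b c, ∑ a, α a * S a b c = 0)
    (X : ι → κ → μ → ℂ) : pair S (dA α X) = pair S X := by
  unfold pair dA
  have h : ∀ b c, ∑ a, S a b c * (X a b c - α a * cA α X b c) = ∑ a, S a b c * X a b c := by
    intro b c
    have h0 : ∑ a, S a b c * (α a * cA α X b c) = 0 := by
      have : ∑ a, S a b c * (α a * cA α X b c) = (∑ a, α a * S a b c) * cA α X b c := by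
        rw [Finset.sum_mul]; exact Finset.sum_congr rfl fun a _ => by ring
      rw [this, hS b c, zero_mul]
    simp_rw [mul_sub]
    rw [Finset.sum_sub_distrib, h0, sub_zero]
  rw [sum_rotate (fun a b c => S a b c * (X a b c - α a * cA α X b c)),
    sum_rotate (fun a b c => S a b c * X a b c)]
  simp_rw [h]

/-- Slot-`b` deflation does not change the pairing with a tensor annihilated by `β` in slot `b`. [folklore] -/
theorem pair_dB (β : κ → ℂ) {S : ι → κ → μ → ℂ} (hS : ∀ a c, ∑ b, β b * S a b c = 0)
    (X : ι → κ → μ → ℂ) : pair S (dB β X) = pair S X := by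
  unfold pair dB
  refine Finset.sum_congr rfl fun a _ => ?_
  have h : ∀ c, ∑ b, S a b c * (X a b c - β b * cB β X a c) = ∑ b, S a b c * X a b c := by
    intro c
    have h0 : ∑ b, S a b c * (β b * cB β X a c) = 0 := by
      have : ∑ b, S a b c * (β b * cB β X a c) = (∑ b, β b * S a b c) * cB β X a c := by
        rw [Finset.sum_mul]; exact Finset.sum_congr rfl fun b _ => by ring
      rw [this, hS a c, zero_mul]
    simp_rw [mul_sub]
    rw [Finset.sum_sub_distrib, h0, sub_zero]
  rw [Finset.sum_comm, Finset.sum_comm (f := fun b c => S a b c * X a b c)]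
  simp_rw [h]

/-- Slot-`c` deflation does not change the pairing with a tensor annihilated by `γ` in slot `c`. [folklore] -/
theorem pair_dC (γ : μ → ℂ) {S : ι → κ → μ → ℂ} (hS : ∀ a b, ∑ c, γ c * S a b c = 0)
    (X : ι → κ → μ → ℂ) : pair S (dC γ X) = pair S X := by
  unfold pair dC
  refine Finset.sum_congr rfl fun a _ => Finset.sum_congr rfl fun b _ => ?_
  have h0 : ∑ c, S a b c * (γ c * cC γ X a b) = 0 := by
    have : ∑ c, S a b c * (γ c * cC γ X a b) = (∑ c, γ c * S a b c) * cC γ X a b := by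
      rw [Finset.sum_mul]; exact Finset.sum_congr rfl fun c _ => by ring
    rw [this, hS a b, zero_mul]
  simp_rw [mul_sub]
  rw [Finset.sum_sub_distrib, h0, sub_zero]

omit [Fintype μ] in
/-- Contracting slot `b` after deflating slot `a`: `cB β (dA α X) a c = cB β X a c − α a · Σ_{a'} conj(α a') cB β X a' c`
(the two slot operations commute). [folklore] -/
theorem cB_dA (α : ι → ℂ) (β : κ → ℂ) (X : ι → κ → μ → ℂ) (a : ι) (c : μ) :
    cB β (dA α X) a c = cB β X a c - α a * ∑ a', conj (α a') * cB β X a' c := by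
  unfold cB dA cA
  have hswap : ∑ b, conj (β b) * (α a * ∑ a', conj (α a') * X a' b c) =
      α a * ∑ a', conj (α a') * ∑ b, conj (β b) * X a' b c := by
    simp_rw [Finset.mul_sum]
    rw [Finset.sum_comm]
    exact Finset.sum_congr rfl fun a' _ => Finset.sum_congr rfl fun b _ => by ring
  simp_rw [mul_sub]
  rw [Finset.sum_sub_distrib, hswap]

omit [Fintype κ] in
/-- Contracting slot `c` after deflating slot `a`. [folklore] -/
theorem cC_dA (α : ι → ℂ) (γ : μ → ℂ) (X : ι → κ → μ → ℂ) (a : ι) (b : κ) :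
    cC γ (dA α X) a b = cC γ X a b - α a * ∑ a', conj (α a') * cC γ X a' b := by
  unfold cC dA cA
  have hswap : ∑ c, conj (γ c) * (α a * ∑ a', conj (α a') * X a' b c) =
      α a * ∑ a', conj (α a') * ∑ c, conj (γ c) * X a' b c := by
    simp_rw [Finset.mul_sum]
    rw [Finset.sum_comm]
    exact Finset.sum_congr rfl fun a' _ => Finset.sum_congr rfl fun c _ => by ring
  simp_rw [mul_sub]
  rw [Finset.sum_sub_distrib, hswap]

omit [Fintype ι] in
/-- Contracting slot `c` after deflating slot `b`. [folklore] -/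
theorem cC_dB (β : κ → ℂ) (γ : μ → ℂ) (X : ι → κ → μ → ℂ) (a : ι) (b : κ) :
    cC γ (dB β X) a b = cC γ X a b - β b * ∑ b', conj (β b') * cC γ X a b' := by
  unfold cC dB cB
  have hswap : ∑ c, conj (γ c) * (β b * ∑ b', conj (β b') * X a b' c) =
      β b * ∑ b', conj (β b') * ∑ c, conj (γ c) * X a b' c := by
    simp_rw [Finset.mul_sum]
    rw [Finset.sum_comm]
    exact Finset.sum_congr rfl fun b' _ => Finset.sum_congr rfl fun c _ => by ring
  simp_rw [mul_sub]
  rw [Finset.sum_sub_distrib, hswap]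

/-- Squared norm of the slot-`b` contraction after a slot-`a` deflation (Pythagoras in slot `a`, fibrewise in `c`).
[folklore] -/
theorem sum_norm_cB_dA (α : ι → ℂ) (hα : ∑ i, ‖α i‖ ^ 2 = 1) (β : κ → ℂ) (X : ι → κ → μ → ℂ) :
    ∑ a, ∑ c, ‖cB β (dA α X) a c‖ ^ 2 =
      (∑ a, ∑ c, ‖cB β X a c‖ ^ 2) - ∑ c, ‖∑ a', conj (α a') * cB β X a' c‖ ^ 2 := by
  simp_rw [cB_dA]
  rw [Finset.sum_comm, Finset.sum_comm (f := fun a c => ‖cB β X a c‖ ^ 2), ← Finset.sum_sub_distrib]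
  exact Finset.sum_congr rfl fun c _ => sum_norm_sq_deflate (fun a => cB β X a c) α hα

/-- Squared norm of the slot-`c` contraction after a slot-`a` deflation. [folklore] -/
theorem sum_norm_cC_dA (α : ι → ℂ) (hα : ∑ i, ‖α i‖ ^ 2 = 1) (γ : μ → ℂ) (X : ι → κ → μ → ℂ) :
    ∑ a, ∑ b, ‖cC γ (dA α X) a b‖ ^ 2 =
      (∑ a, ∑ b, ‖cC γ X a b‖ ^ 2) - ∑ b, ‖∑ a', conj (α a') * cC γ X a' b‖ ^ 2 := by
  simp_rw [cC_dA]
  rw [Finset.sum_comm, Finset.sum_comm (f := fun a b => ‖cC γ X a b‖ ^ 2), ← Finset.sum_sub_distrib]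
  exact Finset.sum_congr rfl fun b _ => sum_norm_sq_deflate (fun a => cC γ X a b) α hα

/-- Squared norm of the slot-`c` contraction after a slot-`b` deflation. [folklore] -/
theorem sum_norm_cC_dB (β : κ → ℂ) (hβ : ∑ i, ‖β i‖ ^ 2 = 1) (γ : μ → ℂ) (X : ι → κ → μ → ℂ) :
    ∑ a, ∑ b, ‖cC γ (dB β X) a b‖ ^ 2 =
      (∑ a, ∑ b, ‖cC γ X a b‖ ^ 2) - ∑ a, ‖∑ b', conj (β b') * cC γ X a b'‖ ^ 2 := by
  simp_rw [cC_dB, ← Finset.sum_sub_distrib]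
  exact Finset.sum_congr rfl fun a _ => sum_norm_sq_deflate (fun b => cC γ X a b) β hβ

end Slots


/-! ## The tensor `⟨2,2,2⟩`: norms of its slot contractions -/

/-- `T₂ = ⟨2,2,2⟩` over `ℂ` (slots `a = (κ,ν)`, `b = (κ,μ)`, `c = (μ,ν)`). -/
def T₂ : P 2 → P 2 → P 2 → ℂ := fun a b c => matMulTensor ℂ 2 2 2 a b c

/-- entries of `T₂` -/
theorem T₂_apply (a b c : P 2) :
    T₂ a b c = if a.1 = b.1 ∧ b.2 = c.1 ∧ a.2 = c.2 then 1 else 0 := rfl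

/-- `pair S T₂ = overlap S` and `nsq S = normSq S` (the line's vocabulary). -/
theorem pair_T₂ (S : P 2 → P 2 → P 2 → ℂ) : pair S T₂ = overlap S := rfl

/-- `nsq = normSq` on the cube `(P 2)³`. -/
theorem nsq_eq_normSq (S : P 2 → P 2 → P 2 → ℂ) : nsq S = normSq S := rfl

/-- `‖T₂‖² = 8` -/
theorem nsq_T₂ : nsq T₂ = 8 := by
  simp only [nsq, T₂_apply, Fintype.sum_prod_type, Fin.sum_univ_two, Fin.isValue]
  norm_num

/-- slot-`a` contraction of `T₂`: `cA α T₂ b c = [b.2 = c.1] · conj α (b.1, c.2)` -/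
theorem cA_T₂ (α : P 2 → ℂ) (b c : P 2) :
    cA α T₂ b c = if b.2 = c.1 then conj (α (b.1, c.2)) else 0 := by
  unfold cA
  by_cases h : b.2 = c.1
  · rw [if_pos h, Finset.sum_eq_single (b.1, c.2)]
    · simp [T₂_apply, h]
    · intro a _ ha
      rw [T₂_apply, if_neg, mul_zero]
      rintro ⟨h1, -, h3⟩
      exact ha (Prod.ext h1 h3)
    · intro hh; exact absurd (Finset.mem_univ _) hh
  · rw [if_neg h]
    refine Finset.sum_eq_zero fun a _ => ?_
    rw [T₂_apply, if_neg, mul_zero]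
    rintro ⟨-, h2, -⟩
    exact h h2

/-- slot-`b` contraction of `T₂`: `cB β T₂ a c = [a.2 = c.2] · conj β (a.1, c.1)` -/
theorem cB_T₂ (β : P 2 → ℂ) (a c : P 2) :
    cB β T₂ a c = if a.2 = c.2 then conj (β (a.1, c.1)) else 0 := by
  unfold cB
  by_cases h : a.2 = c.2
  · rw [if_pos h, Finset.sum_eq_single (a.1, c.1)]
    · simp [T₂_apply, h]
    · intro b _ hb
      rw [T₂_apply, if_neg, mul_zero]
      rintro ⟨h1, h2, -⟩
      exact hb (Prod.ext h1.symm h2)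
    · intro hh; exact absurd (Finset.mem_univ _) hh
  · rw [if_neg h]
    refine Finset.sum_eq_zero fun b _ => ?_
    rw [T₂_apply, if_neg, mul_zero]
    rintro ⟨-, -, h3⟩
    exact h h3

/-- slot-`c` contraction of `T₂`: `cC γ T₂ a b = [a.1 = b.1] · conj γ (b.2, a.2)` -/
theorem cC_T₂ (γ : P 2 → ℂ) (a b : P 2) :
    cC γ T₂ a b = if a.1 = b.1 then conj (γ (b.2, a.2)) else 0 := by
  unfold cC
  by_cases h : a.1 = b.1
  · rw [if_pos h, Finset.sum_eq_single (b.2, a.2)]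
    · simp [T₂_apply, h]
    · intro c _ hc
      rw [T₂_apply, if_neg, mul_zero]
      rintro ⟨-, h2, h3⟩
      exact hc (Prod.ext h2.symm h3.symm)
    · intro hh; exact absurd (Finset.mem_univ _) hh
  · rw [if_neg h]
    refine Finset.sum_eq_zero fun c _ => ?_
    rw [T₂_apply, if_neg, mul_zero]
    rintro ⟨h1, -, -⟩
    exact h h1

/-- `Σ_{b,c} ‖cA α T₂ b c‖² = 2‖α‖²`: every slot marginal of `⟨2,2,2⟩` is `2·id`. -/
theorem sum_norm_cA_T₂ (α : P 2 → ℂ) : ∑ b, ∑ c, ‖cA α T₂ b c‖ ^ 2 = 2 * ∑ a, ‖α a‖ ^ 2 := by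
  simp only [cA_T₂, Fintype.sum_prod_type, Fin.sum_univ_two, Fin.isValue]
  simp
  ring

/-- `Σ_{a,c} ‖cB β T₂ a c‖² = 2‖β‖²` -/
theorem sum_norm_cB_T₂ (β : P 2 → ℂ) : ∑ a, ∑ c, ‖cB β T₂ a c‖ ^ 2 = 2 * ∑ b, ‖β b‖ ^ 2 := by
  simp only [cB_T₂, Fintype.sum_prod_type, Fin.sum_univ_two, Fin.isValue]
  simp
  ring

/-- `Σ_{a,b} ‖cC γ T₂ a b‖² = 2‖γ‖²` -/
theorem sum_norm_cC_T₂ (γ : P 2 → ℂ) : ∑ a, ∑ b, ‖cC γ T₂ a b‖ ^ 2 = 2 * ∑ c, ‖γ c‖ ^ 2 := by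
  simp only [cC_T₂, Fintype.sum_prod_type, Fin.sum_univ_two, Fin.isValue]
  simp
  ring

/-- two-term Cauchy–Schwarz `‖p q + r s‖² ≤ (‖p‖² + ‖r‖²)(‖q‖² + ‖s‖²)` -/
theorem norm_add_mul_sq_le (p q r s : ℂ) :
    ‖p * q + r * s‖ ^ 2 ≤ (‖p‖ ^ 2 + ‖r‖ ^ 2) * (‖q‖ ^ 2 + ‖s‖ ^ 2) := by
  have h := SevenEighthsLaw.norm_sum_mul_sq_le Finset.univ ![p, r] ![q, s]
  simpa [Fin.sum_univ_two] using h

/-- The `(a,b)`-double contraction of `T₂`: `Σ_c ‖Σ_a conj(α a) cB β T₂ a c‖² ≤ ‖α‖²‖β‖²`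
(`= ‖αᵀβ‖²_F`, Cauchy–Schwarz over `κ`). -/
theorem sum_norm_cAB_T₂_le (α β : P 2 → ℂ) :
    ∑ c, ‖∑ a, conj (α a) * cB β T₂ a c‖ ^ 2 ≤ (∑ a, ‖α a‖ ^ 2) * ∑ b, ‖β b‖ ^ 2 := by
  simp only [cB_T₂, Fintype.sum_prod_type, Fin.sum_univ_two, Fin.isValue]
  simp only [Fin.isValue, ↓reduceIte, Fin.one_eq_zero_iff, OfNat.ofNat_ne_one, Fin.zero_eq_one_iff,
    mul_zero, add_zero, zero_add]
  have h00 := norm_add_mul_sq_le (conj (α (0, 0))) (conj (β (0, 0))) (conj (α (1, 0))) (conj (β (1, 0)))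
  have h01 := norm_add_mul_sq_le (conj (α (0, 1))) (conj (β (0, 0))) (conj (α (1, 1))) (conj (β (1, 0)))
  have h10 := norm_add_mul_sq_le (conj (α (0, 0))) (conj (β (0, 1))) (conj (α (1, 0))) (conj (β (1, 1)))
  have h11 := norm_add_mul_sq_le (conj (α (0, 1))) (conj (β (0, 1))) (conj (α (1, 1))) (conj (β (1, 1)))
  simp only [Complex.norm_conj] at h00 h01 h10 h11
  nlinarith [h00, h01, h10, h11, sq_nonneg ‖α (0,0)‖, sq_nonneg ‖α (0,1)‖, sq_nonneg ‖α (1,0)‖,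
    sq_nonneg ‖α (1,1)‖, sq_nonneg ‖β (0,0)‖, sq_nonneg ‖β (0,1)‖, sq_nonneg ‖β (1,0)‖, sq_nonneg ‖β (1,1)‖]

/-! ## Two deficient slots: `|⟨S,⟨2,2,2⟩⟩|² ≤ 5‖S‖²` for `S` of ANY rank -/

/-- squared norm of the doubly deflated tensor `(P_{α⊥} ⊗ P_{β⊥} ⊗ 1) T₂` is at most `5` (`= 8 − 2 − 2 + ‖αᵀβ‖²`). -/
theorem nsq_dB_dA_T₂_le (α β : P 2 → ℂ) (hα : ∑ i, ‖α i‖ ^ 2 = 1) (hβ : ∑ i, ‖β i‖ ^ 2 = 1) :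
    nsq (dB β (dA α T₂)) ≤ 5 := by
  have hw := sum_norm_cAB_T₂_le α β
  rw [nsq_dB β hβ, nsq_dA α hα, nsq_T₂, sum_norm_cA_T₂, sum_norm_cB_dA α hα, sum_norm_cB_T₂, hα, hβ]
  rw [hα, hβ] at hw
  linarith

/-- **Two deficient slots `(a,b)`.** If unit functionals `α`, `β` annihilate the output slot `a` and the slot `b` of `S`
(`Σ_a α a S a b c = 0`, `Σ_b β b S a b c = 0` — every `a`-factor of `S` lies in `ker α`, every `b`-factor in `ker β`),
then `|⟨S,⟨2,2,2⟩⟩|² ≤ 5‖S‖²`, for `S` of ANY rank (the rank-4 rung's constant).  Proof: `⟨S,T⟩ = ⟨S, (P_{α⊥}⊗P_{β⊥}⊗1)T⟩`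
and `‖(P_{α⊥}⊗P_{β⊥}⊗1)T‖² = 4 + ‖αᵀβ‖²_F ≤ 5`. -/
theorem overlap_sq_le_five_of_annihilated_ab (S : P 2 → P 2 → P 2 → ℂ) (α β : P 2 → ℂ)
    (hα : ∑ i, ‖α i‖ ^ 2 = 1) (hβ : ∑ i, ‖β i‖ ^ 2 = 1)
    (hSa : ∀ b c, ∑ a, α a * S a b c = 0) (hSb : ∀ a c, ∑ b, β b * S a b c = 0) :
    ‖overlap S‖ ^ 2 ≤ 5 * normSq S := by
  have hp : overlap S = pair S (dB β (dA α T₂)) := by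
    rw [pair_dB β hSb, pair_dA α hSa, pair_T₂]
  rw [hp]
  calc ‖pair S (dB β (dA α T₂))‖ ^ 2 ≤ nsq S * nsq (dB β (dA α T₂)) := norm_pair_sq_le _ _
    _ ≤ nsq S * 5 := mul_le_mul_of_nonneg_left (nsq_dB_dA_T₂_le α β hα hβ) (nsq_nonneg S)
    _ = 5 * normSq S := by rw [nsq_eq_normSq, mul_comm]

/-- **Registered stub `stub_twoDeficientSlots`** (raw form of `overlap_sq_le_five_of_annihilated_ab`): two deficient
slots give the rank-4 rung's bound `5`, for tensors of any rank. -/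
theorem stub_twoDeficientSlots : ∀ (S : Fin 2 × Fin 2 → Fin 2 × Fin 2 → Fin 2 × Fin 2 → ℂ) (α β : Fin 2 × Fin 2 → ℂ), (∑ i, ‖α i‖ ^ 2) = 1 → (∑ i, ‖β i‖ ^ 2) = 1 → (∀ b c, (∑ a, α a * S a b c) = 0) → (∀ a c, (∑ b, β b * S a b c) = 0) → ‖∑ a, ∑ b, ∑ c, S a b c * matMulTensor ℂ 2 2 2 a b c‖ ^ 2 ≤ 5 * ∑ a, ∑ b, ∑ c, ‖S a b c‖ ^ 2 :=
  fun S α β hα hβ hSa hSb => overlap_sq_le_five_of_annihilated_ab S α β hα hβ hSa hSb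

end Summit.MatrixMultiplication.MatrixMultiplication.Theorems.LinearDefectLaw.SlotDeflation

end
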